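import Literature.NumberTheory.Rogawski1990.ArchHCOrbitalFamilyGExt     -- ★ (G′-EXT) (LH3-p02 (g2)): `orbFamGExt`, `archHcPeriodic_orbFamGExt`; brings ★ `ArchHcPeriodic`, `InRegG`, `angleShift`, `add_angleShift_mem_inRegG_iff`
import HarnessLib

/-!
# Clause (I₁) of Harish-Chandra's space for a `G′`-family is LOCAL AT THE NONCOMPACT WALLS, and reduces to the fundamental cube under periodicity (P)
# ((B1) «box reduction», `G′` twin of ★ `ArchBouazizSmoothBoundedSlab`; Bouaziz 1994 §3.1, Shelstad 1979 §4)

Topic `NumberTheory/Rogawski1990`; namespace `Literature.NumberTheory.Rogawski1990`.  THEOREMS ONLY (no definition, no instance, no notation, no axiom,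
no named fact, no `sorry`).  Cell `pub/hodgecm-mathlib`, line LH3 (closer stub `stub_N9`, crux H413 = `stmt-HodgeConjecture-24833`), letter L1
`HcOrbitalFamiliesStatement`, clause (I₁) = the second conjunct of ★ `ArchHcSmoothOneSided` (`ArchHCSpaceG.lean` :190) for the extended genuine family
★ `orbFamGExt` — brick **(B1)** of LH3-plan (g3)'s RULING #15 (2026-09-02T10:04:19Z) on the (I₁-CENSUS) `F0/P3c/LH7/LH7-p04/g4/CENSUS-I1.v1.md`
(LH7-p04 (g4), (I₁) spec-owner).  Count-neutral.

THE MATHEMATICS.  (I₁) asks, for every chart `S′`, every `n` and every compact `K`: `‖iteratedFDeriv ℝ n (F S′) ·‖` is bounded on `K ∩ InRegG s S′`.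
* §1 (generic, any normed spaces): a real function bounded NEAR EVERY POINT of a compact `K` (on `U_x ∩ A`, `U_x ∈ 𝓝 x`) is bounded on `K ∩ A` (finite
  subcover); at a point of an OPEN set `O` on which `g` is `C^∞` every jet is bounded near the point (continuity of `iteratedFDeriv`, ★ Mathlib
  `ContDiffOn.continuousOn_iteratedFDerivWithin` + `iteratedFDerivWithin_of_isOpen`); hence bounded jets on `K ∩ O` for ALL compact `K` follow from smoothness on
  `O` plus local bounds at the points `x ∉ O` only (`bddAbove_norm_iteratedFDeriv_image_inter_of_forall_not_mem`) — for (I₁): at the points of the NONCOMPACT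
  IMAGINARY WALLS only (the complement of ★ `InRegG`), since (A5)∕(I₂) gives `ContDiffOn ℝ ∞` on the open `InRegG`.
* §2 (the angle lattice): the simultaneous shift `Σ_{w ∉ S′} Σ_i angleShift w i (k w i)` reads `2π k_{w,i}` in coordinates, preserves `InRegG` (★
  `add_angleShift_mem_inRegG_iff`), fixes every (P)-periodic family (★ `ArchHcPeriodic`), and carries every point into the FUNDAMENTAL CUBE
  `{c | ∀ w ∉ S′, ∀ i, c w i ∈ [0, 2π)}` at the compact places (`k_{w,i} = −⌊c_{w,i}∕2π⌋`).
* §3 HEAD **`smoothBounded_of_periodic_of_forall_wall`**: for a (P)-periodic family, (I₂) on `InRegG` + a local jet bound at every wall point OF THE FUNDAMENTAL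
  CUBE give (I₁)+(I₂) for all charts, all `n`, all compact `K` (`iteratedFDeriv` commutes with translations, Mathlib `iteratedFDeriv_comp_add_right`).  The wall
  points of the cube at a compact place of signature `(2,1)` are its FACES (one noncompact coincidence `e^{iθ_i} = e^{iθ_k}`, semiregular) and its
  COMPACT-SCALAR CORNERS (`e^{iθ_1} = e^{iθ_2} = e^{iθ_3}`) — the strata (F)∕(X)∕(C) of the census; this file does not claim any of those local bounds.
* §4 the instance for ★ `orbFamGExt` ((P) discharged by ★ `archHcPeriodic_orbFamGExt`): **`smoothBounded_orbFamGExt_of_forall_wall`** — the `h1` of the rider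
  ★ `archHcSmoothOneSided_of_smoothBounded_of_jump` from (A5) + local wall bounds in the cube.
HONEST LABEL: bookkeeping only (no analysis); HC_CM is proved only modulo the 7 printed citations (2 remaining: hLiu418 = stmt-HodgeConjecture-24832,
h413 = stmt-HodgeConjecture-24833) until rung 0 closes.

## References
* [Bouaziz1994IntegralesOrbitales] A. Bouaziz, *Intégrales orbitales sur les groupes de Lie réductifs*, Ann. Sci. ÉNS 27 (1994), §3.1 p. 579 ((I₁), (I₂)), §6.2 p. 591.
* [Shelstad1979] D. Shelstad, *Characters and inner forms of a quasi-split group over ℝ*, Compositio Math. 39 (1979), §4 pp. 22–23.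
* [Varadarajan1977] V. S. Varadarajan, *Harmonic Analysis on Real Reductive Groups*, LNM 576 (1977), Part I §1.12.
-/

set_option autoImplicit false

noncomputable section

open Set Function Real Filter Topology MeasureTheory NumberField NumberField.InfinitePlace
open Literature.NumberTheory.Automorphic Literature.NumberTheory.Automorphic.ArchCartan Literature.NumberTheory.Automorphic.UnitaryGroup
open scoped ContDiff Classical

namespace Literature.NumberTheory.Rogawski1990

/-! ## §1 Local-to-compact bookkeeping (generic) -/

section Local

variable {X : Type*} [TopologicalSpace X]

/-- **A function bounded near every point of a compact set is bounded on it** (relative version: on `K ∩ A`, from bounds on `U_x ∩ A`, `U_x ∈ 𝓝 x`, by a finite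
subcover). [cite: Bouaziz1994IntegralesOrbitales, §3.1 p. 579] -/
theorem bddAbove_image_inter_of_forall_exists_nhds {f : X → ℝ} {A K : Set X} (hK : IsCompact K)
    (h : ∀ x ∈ K, ∃ U ∈ 𝓝 x, BddAbove (f '' (U ∩ A))) : BddAbove (f '' (K ∩ A)) := by
  classical
  choose! U hU hB using h
  obtain ⟨t, htK, hKt⟩ := hK.elim_nhds_subcover U fun x hx => hU x hx
  have hM : ∀ x ∈ t, ∃ M : ℝ, ∀ y ∈ U x ∩ A, f y ≤ M := fun x hx => by
    obtain ⟨M, hM⟩ := hB x (htK x hx)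
    exact ⟨M, fun y hy => hM ⟨y, hy, rfl⟩⟩
  choose! M hM using hM
  refine ⟨∑ x ∈ t, |M x|, ?_⟩
  rintro _ ⟨y, ⟨hyK, hyA⟩, rfl⟩
  obtain ⟨x, hxt, hyU⟩ := mem_iUnion₂.1 (hKt hyK)
  exact (hM x hxt y ⟨hyU, hyA⟩).trans ((le_abs_self _).trans (Finset.single_le_sum (fun i _ => abs_nonneg (M i)) hxt))

/-- The points off the closure of `A` are trivial: `(closure A)ᶜ` is a neighbourhood meeting `A` in `∅` (so local bounds are a condition at the points of
`closure A ∖ A` only). [cite: Bouaziz1994IntegralesOrbitales, §3.1 p. 579] -/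
theorem exists_nhds_bddAbove_image_inter_of_not_mem_closure {f : X → ℝ} {A : Set X} {x : X} (hx : x ∉ closure A) :
    ∃ U ∈ 𝓝 x, BddAbove (f '' (U ∩ A)) := by
  refine ⟨(closure A)ᶜ, isClosed_closure.isOpen_compl.mem_nhds hx, ⟨0, ?_⟩⟩
  rintro _ ⟨y, ⟨hy, hyA⟩, rfl⟩
  exact absurd (subset_closure hyA) hy

variable {E F : Type*} [NormedAddCommGroup E] [NormedSpace ℝ E] [NormedAddCommGroup F] [NormedSpace ℝ F]

/-- **At a point of an open set on which `g` is `C^∞`, every jet of `g` is bounded near the point** (continuity of `iteratedFDeriv ℝ n g` on the open set).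
[cite: Bouaziz1994IntegralesOrbitales, §3.1 (I₂) p. 579] -/
theorem exists_nhds_bddAbove_norm_iteratedFDeriv_of_contDiffOn {g : E → F} {O : Set E} (hO : IsOpen O) (hg : ContDiffOn ℝ ∞ g O) {x : E} (hx : x ∈ O)
    (n : ℕ) : ∃ U ∈ 𝓝 x, BddAbove ((fun c => ‖iteratedFDeriv ℝ n g c‖) '' (U ∩ O)) := by
  have hcont : ContinuousOn (iteratedFDeriv ℝ n g) O :=
    (hg.continuousOn_iteratedFDerivWithin (m := n) (by exact_mod_cast le_top) hO.uniqueDiffOn).congr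
      fun y hy => (iteratedFDerivWithin_of_isOpen n hO hy).symm
  have hca : ContinuousAt (fun c => ‖iteratedFDeriv ℝ n g c‖) x := (hcont.continuousAt (hO.mem_nhds hx)).norm
  have hev : ∀ᶠ y in 𝓝 x, ‖iteratedFDeriv ℝ n g y‖ < ‖iteratedFDeriv ℝ n g x‖ + 1 :=
    Filter.Tendsto.eventually_lt_const (lt_add_one _) hca
  exact ⟨_, hev, ‖iteratedFDeriv ℝ n g x‖ + 1, by rintro _ ⟨y, ⟨hy, -⟩, rfl⟩; exact le_of_lt hy⟩

/-- **Bounded jets on `K ∩ O` for every compact `K`, from smoothness on the open `O` and local bounds at the points OUTSIDE `O` only** (the points of `O`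
are served by `exists_nhds_bddAbove_norm_iteratedFDeriv_of_contDiffOn`, the points off the closure trivially). [cite: Bouaziz1994IntegralesOrbitales, §3.1 (I₁) p. 579] -/
theorem bddAbove_norm_iteratedFDeriv_image_inter_of_forall_not_mem {g : E → F} {O : Set E} (hO : IsOpen O) (hg : ContDiffOn ℝ ∞ g O) (n : ℕ)
    (hwall : ∀ x, x ∉ O → ∃ U ∈ 𝓝 x, BddAbove ((fun c => ‖iteratedFDeriv ℝ n g c‖) '' (U ∩ O))) {K : Set E} (hK : IsCompact K) :
    BddAbove ((fun c => ‖iteratedFDeriv ℝ n g c‖) '' (K ∩ O)) := by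
  refine bddAbove_image_inter_of_forall_exists_nhds hK fun x _ => ?_
  by_cases hx : x ∈ O
  · exact exists_nhds_bddAbove_norm_iteratedFDeriv_of_contDiffOn hO hg hx n
  · exact hwall x hx

/-- **Translation of a local bound**: if `g = g ∘ (· + v)` (e.g. by periodicity) and the jets of `g` are bounded on `U₀ ∩ O` near `x + v`, with `O`
stable under `· + v`, then they are bounded near `x` on `((· + v) ⁻¹' U₀) ∩ O` (Mathlib `iteratedFDeriv_comp_add_right`). [cite: Shelstad1979, §4 p. 22] -/
theorem exists_nhds_bddAbove_norm_iteratedFDeriv_of_comp_add {g : E → F} {O : Set E} (v : E) (hg : g = fun c => g (c + v))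
    (hO : ∀ c, c ∈ O → c + v ∈ O) (n : ℕ) {x : E} (h : ∃ U ∈ 𝓝 (x + v), BddAbove ((fun c => ‖iteratedFDeriv ℝ n g c‖) '' (U ∩ O))) :
    ∃ U ∈ 𝓝 x, BddAbove ((fun c => ‖iteratedFDeriv ℝ n g c‖) '' (U ∩ O)) := by
  obtain ⟨U₀, hU₀, M, hM⟩ := h
  refine ⟨(fun c => c + v) ⁻¹' U₀, (continuous_id.add continuous_const).continuousAt.preimage_mem_nhds hU₀, M, ?_⟩
  rintro _ ⟨c, ⟨hcU, hcO⟩, rfl⟩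
  have hD : iteratedFDeriv ℝ n g c = iteratedFDeriv ℝ n g (c + v) := by
    conv_lhs => rw [hg]
    exact iteratedFDeriv_comp_add_right n v c
  show ‖iteratedFDeriv ℝ n g c‖ ≤ M
  rw [hD]
  exact hM ⟨c + v, ⟨hcU, hO c hcO⟩, rfl⟩

end Local

/-! ## §2 The angle lattice on the `G′`-atlas: coordinates, `InRegG`-invariance, periodic invariance, the fundamental cube -/

section Lattice

variable {W : Type*} [Fintype W] [DecidableEq W]

omit [Fintype W] in
/-- The simultaneous shift `Σ_{(w,i) ∈ T} angleShift w i (k w i)` read in coordinates: `2π k_{w,i}` at the pairs of `T`, `0` elsewhere.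
[cite: Shelstad1979, §4 p. 22] -/
theorem sum_angleShift_apply_eq (T : Finset (W × Fin 3)) (k : W → Fin 3 → ℤ) (w : W) (i : Fin 3) :
    (∑ p ∈ T, angleShift p.1 p.2 (k p.1 p.2) : W → Fin 3 → ℝ) w i = if (w, i) ∈ T then 2 * π * k w i else 0 := by
  rw [Finset.sum_apply, Finset.sum_apply]
  have hterm : ∀ p : W × Fin 3, (angleShift p.1 p.2 (k p.1 p.2) : W → Fin 3 → ℝ) w i = if p = (w, i) then 2 * π * k w i else 0 := by
    rintro ⟨w', i'⟩
    by_cases hw : w = w'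
    · subst hw
      by_cases hi : i = i'
      · subst hi
        simp [angleShift_apply_self]
      · rw [angleShift_apply_self_of_ne w hi]
        simp [Ne.symm hi]
    · rw [angleShift_apply_of_ne hw, Pi.zero_apply]
      simp [Ne.symm hw]
  simp_rw [hterm]
  rw [Finset.sum_ite_eq' T (w, i)]

omit [Fintype W] in
/-- **`InRegG` is invariant under every finite sum of angle shifts** (★ `add_angleShift_mem_inRegG_iff`, by induction on the sum).
[cite: Bouaziz1994IntegralesOrbitales, §6.2 p. 591] -/
theorem add_sum_angleShift_mem_inRegG_iff (s : W → Fin 3 → SignType) (S' : Finset W) (T : Finset (W × Fin 3)) (k : W → Fin 3 → ℤ)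
    (c : W → Fin 3 → ℝ) : c + ∑ p ∈ T, angleShift p.1 p.2 (k p.1 p.2) ∈ InRegG s S' ↔ c ∈ InRegG s S' := by
  induction T using Finset.induction_on generalizing c with
  | empty => rw [Finset.sum_empty, add_zero]
  | insert a T ha ih =>
    rw [Finset.sum_insert ha, ← add_assoc, add_right_comm, add_angleShift_mem_inRegG_iff]
    exact ih c

omit [Fintype W] in
/-- **(P) ⇒ invariance under every finite sum of ANGULAR shifts** (pairs `(w, i)` with `w ∉ S′ ∨ i ≠ 0`). [cite: Shelstad1979, §4 p. 22]
[cite: Bouaziz1994IntegralesOrbitales, §3.1 p. 579] -/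
theorem apply_add_sum_angleShift_of_archHcPeriodic {F : Finset W → (W → Fin 3 → ℝ) → ℂ} (hP : ArchHcPeriodic F) (S' : Finset W)
    (T : Finset (W × Fin 3)) (hT : ∀ p ∈ T, p.1 ∉ S' ∨ p.2 ≠ 0) (k : W → Fin 3 → ℤ) (c : W → Fin 3 → ℝ) :
    F S' (c + ∑ p ∈ T, angleShift p.1 p.2 (k p.1 p.2)) = F S' c := by
  induction T using Finset.induction_on generalizing c with
  | empty => rw [Finset.sum_empty, add_zero]
  | insert a T ha ih =>
    rw [Finset.sum_insert ha, ← add_assoc, add_right_comm, hP S' _ a.1 a.2 (k a.1 a.2) (hT a (Finset.mem_insert_self a T))]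
    exact ih (fun p hp => hT p (Finset.mem_insert_of_mem hp)) c

omit [Fintype W] in
/-- … hence `F S′` equals its own translate by the shift, as a function. [cite: Shelstad1979, §4 p. 22] -/
theorem eq_comp_add_sum_angleShift_of_archHcPeriodic {F : Finset W → (W → Fin 3 → ℝ) → ℂ} (hP : ArchHcPeriodic F) (S' : Finset W)
    (T : Finset (W × Fin 3)) (hT : ∀ p ∈ T, p.1 ∉ S' ∨ p.2 ≠ 0) (k : W → Fin 3 → ℤ) :
    F S' = fun c => F S' (c + ∑ p ∈ T, angleShift p.1 p.2 (k p.1 p.2)) :=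
  funext fun c => (apply_add_sum_angleShift_of_archHcPeriodic hP S' T hT k c).symm

/-- **Every point is carried into the fundamental cube at the compact places** by the shift with `k_{w,i} = −⌊c_{w,i}∕2π⌋` on `T = S′ᶜ × Fin 3`:
`(c + shift) w i ∈ [0, 2π)` for `w ∉ S′`. [cite: Shelstad1979, §4 p. 22] -/
theorem add_sum_angleShift_mem_Ico (S' : Finset W) (c : W → Fin 3 → ℝ) (k : W → Fin 3 → ℤ) (hk : ∀ w i, k w i = -⌊c w i / (2 * π)⌋)
    {w : W} (hw : w ∉ S') (i : Fin 3) :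
    (c + ∑ p ∈ S'ᶜ ×ˢ (Finset.univ : Finset (Fin 3)), angleShift p.1 p.2 (k p.1 p.2)) w i ∈ Ico 0 (2 * π) := by
  have hmem : (w, i) ∈ S'ᶜ ×ˢ (Finset.univ : Finset (Fin 3)) := Finset.mem_product.2 ⟨Finset.mem_compl.2 hw, Finset.mem_univ i⟩
  have happ : (c + ∑ p ∈ S'ᶜ ×ˢ (Finset.univ : Finset (Fin 3)), angleShift p.1 p.2 (k p.1 p.2)) w i = c w i + 2 * π * k w i := by
    rw [Pi.add_apply, Pi.add_apply, sum_angleShift_apply_eq, if_pos hmem]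
  rw [happ, hk w i]
  have hfl := Int.floor_le (c w i / (2 * π))
  have hlt := Int.lt_floor_add_one (c w i / (2 * π))
  have hid : 2 * π * (c w i / (2 * π)) = c w i := by field_simp
  have hle : 2 * π * (⌊c w i / (2 * π)⌋ : ℝ) ≤ c w i := by
    have := mul_le_mul_of_nonneg_left hfl Real.two_pi_pos.le
    rwa [hid] at this
  have hlt' : c w i < 2 * π * ((⌊c w i / (2 * π)⌋ : ℝ) + 1) := by
    have := mul_lt_mul_of_pos_left hlt Real.two_pi_pos
    rwa [hid] at this
  push_cast
  constructor
  · linarith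
  · linarith

end Lattice

/-! ## §3 HEAD: (I₁)+(I₂) from (I₂) and LOCAL wall bounds in the fundamental cube, for a (P)-periodic family -/

section Head

variable {W : Type*} [Fintype W] [DecidableEq W] {s : W → Fin 3 → SignType} {F : Finset W → (W → Fin 3 → ℝ) → ℂ}

omit [DecidableEq W] in
/-- **(I₁) IS LOCAL AT THE WALLS (no periodicity)**: smoothness on the open ★ `InRegG s S′` and, for each `n`, a bound of the `n`-jet on `U_x ∩ InRegG s S′` near every
point `x ∉ InRegG s S′` (a point on a noncompact imaginary wall at a compact place) give the (I₁) bound on `K ∩ InRegG s S′` for every compact `K`.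
[cite: Bouaziz1994IntegralesOrbitales, §3.1 (I₁) p. 579] [cite: Shelstad1979, §4 p. 23] -/
theorem bddAbove_norm_iteratedFDeriv_inter_inRegG_of_forall_wall (S' : Finset W) (h1 : ContDiffOn ℝ ∞ (F S') (InRegG s S')) (n : ℕ)
    (h2 : ∀ x : W → Fin 3 → ℝ, x ∉ InRegG s S' → ∃ U ∈ 𝓝 x, BddAbove ((fun c => ‖iteratedFDeriv ℝ n (F S') c‖) '' (U ∩ InRegG s S')))
    {K : Set (W → Fin 3 → ℝ)} (hK : IsCompact K) : BddAbove ((fun c => ‖iteratedFDeriv ℝ n (F S') c‖) '' (K ∩ InRegG s S')) :=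
  bddAbove_norm_iteratedFDeriv_image_inter_of_forall_not_mem (isOpen_inRegG s S') h1 n h2 hK

/-- **PERIODIC REDUCTION OF THE WALL CONDITION TO THE FUNDAMENTAL CUBE**: for a (P)-periodic family it suffices to bound the jets near the wall points `x` with
`x w i ∈ [0, 2π)` at every compact place `w ∉ S′` (all slots). [cite: Shelstad1979, §4 p. 22] [cite: Bouaziz1994IntegralesOrbitales, §3.1 p. 579] -/
theorem forall_wall_of_forall_wall_cube (hP : ArchHcPeriodic F) (S' : Finset W) (n : ℕ)
    (h2 : ∀ x : W → Fin 3 → ℝ, x ∉ InRegG s S' → (∀ w, w ∉ S' → ∀ i : Fin 3, x w i ∈ Ico 0 (2 * π)) →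
      ∃ U ∈ 𝓝 x, BddAbove ((fun c => ‖iteratedFDeriv ℝ n (F S') c‖) '' (U ∩ InRegG s S')))
    (x : W → Fin 3 → ℝ) (hx : x ∉ InRegG s S') :
    ∃ U ∈ 𝓝 x, BddAbove ((fun c => ‖iteratedFDeriv ℝ n (F S') c‖) '' (U ∩ InRegG s S')) := by
  set k : W → Fin 3 → ℤ := fun w i => -⌊x w i / (2 * π)⌋ with hk
  set v : W → Fin 3 → ℝ := ∑ p ∈ S'ᶜ ×ˢ (Finset.univ : Finset (Fin 3)), angleShift p.1 p.2 (k p.1 p.2) with hv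
  have hT : ∀ p ∈ S'ᶜ ×ˢ (Finset.univ : Finset (Fin 3)), p.1 ∉ S' ∨ p.2 ≠ (0 : Fin 3) :=
    fun p hp => Or.inl (Finset.mem_compl.1 (Finset.mem_product.1 hp).1)
  refine exists_nhds_bddAbove_norm_iteratedFDeriv_of_comp_add v (eq_comp_add_sum_angleShift_of_archHcPeriodic hP S' _ hT k)
    (fun c hc => (add_sum_angleShift_mem_inRegG_iff s S' _ k c).2 hc) n (h2 (x + v) ?_ ?_)
  · exact fun h => hx ((add_sum_angleShift_mem_inRegG_iff s S' _ k x).1 h)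
  · exact fun w hw i => add_sum_angleShift_mem_Ico S' x k (fun _ _ => rfl) hw i

/-- **HEAD — (I₁)+(I₂) FOR A PERIODIC `G′`-FAMILY FROM (I₂) AND LOCAL WALL BOUNDS IN THE FUNDAMENTAL CUBE.**  For `F` periodic in the angle slots (★ `ArchHcPeriodic`),
`ContDiffOn ℝ ∞ (F S′) (InRegG s S′)` for every chart (clause (I₂), the E3 head (A5) for the genuine family) and, for every chart, order `n` and WALL POINT `x ∉ InRegG s S′`
OF THE FUNDAMENTAL CUBE (`x w i ∈ [0, 2π)` at the compact places), a bound of the `n`-jet on `U ∩ InRegG s S′` for some `U ∈ 𝓝 x`, together give the «smooth-bounded»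
conjunction (I₂) ∧ (I₁) of ★ `ArchHcSmoothOneSided` on every chart, every `n`, every compact `K` — the `h1` of the rider ★ `archHcSmoothOneSided_of_smoothBounded_of_jump`.
At a compact place of signature `(2,1)` the cube's wall points are FACES (one noncompact coincidence; semiregular) and COMPACT-SCALAR CORNERS (`e^{iθ_1} = e^{iθ_2} = e^{iθ_3}`);
neither local bound is claimed here. [cite: Bouaziz1994IntegralesOrbitales, §3.1 (I₁)–(I₂) p. 579; §6.2 p. 591] [cite: Shelstad1979, §4 pp. 22–23] [cite: Varadarajan1977, I §1.12] -/
theorem smoothBounded_of_periodic_of_forall_wall (hP : ArchHcPeriodic F) (h1 : ∀ S' : Finset W, ContDiffOn ℝ ∞ (F S') (InRegG s S'))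
    (h2 : ∀ (S' : Finset W) (n : ℕ) (x : W → Fin 3 → ℝ), x ∉ InRegG s S' → (∀ w, w ∉ S' → ∀ i : Fin 3, x w i ∈ Ico 0 (2 * π)) →
      ∃ U ∈ 𝓝 x, BddAbove ((fun c => ‖iteratedFDeriv ℝ n (F S') c‖) '' (U ∩ InRegG s S'))) :
    ∀ S' : Finset W, ContDiffOn ℝ ∞ (F S') (InRegG s S') ∧
      ∀ (n : ℕ) (K : Set (W → Fin 3 → ℝ)), IsCompact K → BddAbove ((fun c => ‖iteratedFDeriv ℝ n (F S') c‖) '' (K ∩ InRegG s S')) :=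
  fun S' => ⟨h1 S', fun n _ hK =>
    bddAbove_norm_iteratedFDeriv_inter_inRegG_of_forall_wall S' (h1 S') n (forall_wall_of_forall_wall_cube hP S' n (h2 S' n)) hK⟩

end Head

/-! ## §4 The extended genuine family `orbFamGExt` ((P) is ★ `archHcPeriodic_orbFamGExt`) -/

section Genuine

variable (L : Type) [Field L] [NumberField L] [IsCMField L] (α : Fin 3 → L)
  [MeasurableSpace ↥(arch (↥(maximalRealSubfield L)) L (IsCMField.complexConj L) 3 (Matrix.diagonal α))]
  [BorelSpace ↥(arch (↥(maximalRealSubfield L)) L (IsCMField.complexConj L) 3 (Matrix.diagonal α))]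
  (ν' : Measure ↥(arch (↥(maximalRealSubfield L)) L (IsCMField.complexConj L) 3 (Matrix.diagonal α))) [ν'.IsHaarMeasure] [ν'.IsMulRightInvariant]

/-- **(B1) FOR THE GENUINE FAMILY — «SMOOTH-BOUNDED» FROM (A5) AND LOCAL WALL BOUNDS IN THE FUNDAMENTAL CUBE**: for every `a′`, clause (I₂) of letter L1 on every chart
(`h1`, the E3 head `contDiffOn_orbFamGExt_inRegG`) and a local bound of every jet at every wall point of the fundamental cube (`h2`: faces — the `U(1,1)` model with parameters;
compact-scalar corners — Harish-Chandra's local boundedness at central points of `U(2,1)_w`) give the `h1` of ★ `archHcSmoothOneSided_of_smoothBounded_of_jump` for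
★ `orbFamGExt L α ν′ a′`, i.e. (I₁)+(I₂) on all of `InRegG (slotSign L α) S′` for every chart, order and compact set.
[cite: Bouaziz1994IntegralesOrbitales, §3.1 (I₁)–(I₂) p. 579] [cite: Shelstad1979, §4 pp. 22–23] [cite: Varadarajan1977, I §1.12] -/
theorem smoothBounded_orbFamGExt_of_forall_wall (a' : ↥(arch (↥(maximalRealSubfield L)) L (IsCMField.complexConj L) 3 (Matrix.diagonal α)) → ℂ)
    (h1 : ∀ S' : Finset {w : InfinitePlace L // IsComplex w}, ContDiffOn ℝ ∞ (orbFamGExt L α ν' a' S') (InRegG (slotSign L α) S'))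
    (h2 : ∀ (S' : Finset {w : InfinitePlace L // IsComplex w}) (n : ℕ) (x : {w : InfinitePlace L // IsComplex w} → Fin 3 → ℝ),
      x ∉ InRegG (slotSign L α) S' → (∀ w, w ∉ S' → ∀ i : Fin 3, x w i ∈ Ico 0 (2 * π)) →
        ∃ U ∈ 𝓝 x, BddAbove ((fun c => ‖iteratedFDeriv ℝ n (orbFamGExt L α ν' a' S') c‖) '' (U ∩ InRegG (slotSign L α) S'))) :
    ∀ S' : Finset {w : InfinitePlace L // IsComplex w}, ContDiffOn ℝ ∞ (orbFamGExt L α ν' a' S') (InRegG (slotSign L α) S') ∧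
      ∀ (n : ℕ) (K : Set ({w : InfinitePlace L // IsComplex w} → Fin 3 → ℝ)), IsCompact K →
        BddAbove ((fun c => ‖iteratedFDeriv ℝ n (orbFamGExt L α ν' a' S') c‖) '' (K ∩ InRegG (slotSign L α) S')) :=
  smoothBounded_of_periodic_of_forall_wall (archHcPeriodic_orbFamGExt L α ν' a') h1 h2

/-- **… and without the cube restriction** (local bounds at ALL wall points; no periodicity used). [cite: Bouaziz1994IntegralesOrbitales, §3.1 (I₁) p. 579] -/
theorem bddAbove_norm_iteratedFDeriv_orbFamGExt_of_forall_wall (a' : ↥(arch (↥(maximalRealSubfield L)) L (IsCMField.complexConj L) 3 (Matrix.diagonal α)) → ℂ)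
    (S' : Finset {w : InfinitePlace L // IsComplex w}) (h1 : ContDiffOn ℝ ∞ (orbFamGExt L α ν' a' S') (InRegG (slotSign L α) S')) (n : ℕ)
    (h2 : ∀ x : {w : InfinitePlace L // IsComplex w} → Fin 3 → ℝ, x ∉ InRegG (slotSign L α) S' →
      ∃ U ∈ 𝓝 x, BddAbove ((fun c => ‖iteratedFDeriv ℝ n (orbFamGExt L α ν' a' S') c‖) '' (U ∩ InRegG (slotSign L α) S')))
    {K : Set ({w : InfinitePlace L // IsComplex w} → Fin 3 → ℝ)} (hK : IsCompact K) :
    BddAbove ((fun c => ‖iteratedFDeriv ℝ n (orbFamGExt L α ν' a' S') c‖) '' (K ∩ InRegG (slotSign L α) S')) :=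
  bddAbove_norm_iteratedFDeriv_inter_inRegG_of_forall_wall S' h1 n h2 hK

end Genuine

end Literature.NumberTheory.Rogawski1990

end
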